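import Summits.Ventures.PercRepro.C041ZoneReduction

/-!
# The abstract counting layer in SPLIT FORM: a state set with a zone projection (p6, gen 26; C-041.md §11 (e))

`C041ZoneReduction` states the REDUCTION THEOREM's two product bounds on the product type `(∀ i, S i) × T` itself.
The percolation dictionary of §11 produces instead a finite set `s` of global states (the cube states of `O`) with a
ZONE PROJECTION `split : α → (∀ i, S i) × T` (the zone-states `σ_Z = (X ∩ B_Z, τ|_Z)` and the states of the zones
missing `K₀`); the product decomposition is the pair of facts «`split` is injective on `s`» (a state is determined by
its zone parts) and «every tuple of admissible zone-states is a state» (`(F2)`, admissibility is per zone).  This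
file transports the bounds along such a projection:

* `card_inv_not_rho_le_of_split`: (H1) through `split` and `InjOn split s` give
  `#{σ ∈ s | inv ∧ ¬rho} ≤ (∏ i, (#L i + #U i) − ∏ i, #U i) · #T`;
* `le_card_not_inv_not_good_rho_of_split`: (H2) through `split` and `SurjOn split s (mixed R U ×ˢ univ)` give
  `(∏ i, (#R i + #U i) − ∏ i, #U i) · #T ≤ #{σ ∈ s | ¬inv ∧ ¬good ∧ rho}`;
* `card_le_of_zone_card_le_of_split`: the ZONE-LEMMA FORM on `s`.

The dictionary then only has to supply `split`, the two product facts and (H1), (H2).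
-/

namespace PercRepro

namespace ZoneReduction

open Finset

variable {ι : Type*} [Fintype ι] [DecidableEq ι] {S : ι → Type*} [∀ i, DecidableEq (S i)]
  {T : Type*} [Fintype T]
variable {α : Type*} (s : Finset α) (split : α → (∀ i, S i) × T) (inv rho good : α → Prop)
  [DecidablePred inv] [DecidablePred rho] [DecidablePred good]

/-- **LEFT BOUND, split form**: (H1) through the projection and injectivity of the projection on `s` give
`#{σ ∈ s | inv ∧ ¬rho} ≤ (∏ i, (#L i + #U i) − ∏ i, #U i) · #T`. -/
theorem card_inv_not_rho_le_of_split (L U : ∀ i, Finset (S i)) (hLU : ∀ i, Disjoint (L i) (U i))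
    (hinj : Set.InjOn split s)
    (H1 : ∀ σ ∈ s, inv σ → ¬ rho σ → (∀ i, (split σ).1 i ∈ L i ∪ U i) ∧ ∃ i, (split σ).1 i ∈ L i) :
    (s.filter fun σ => inv σ ∧ ¬ rho σ).card
      ≤ (∏ i, ((L i).card + (U i).card) - ∏ i, (U i).card) * Fintype.card T := by
  rw [← card_mixed L U hLU, ← Finset.card_univ, ← Finset.card_product]
  apply Finset.card_le_card_of_injOn split
  · intro σ hσ
    rw [Finset.mem_coe, Finset.mem_filter] at hσ
    obtain ⟨h1, i, hi⟩ := H1 σ hσ.1 hσ.2.1 hσ.2.2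
    rw [Finset.mem_coe, Finset.mem_product, mem_mixed]
    refine ⟨⟨h1, fun hU => ?_⟩, Finset.mem_univ _⟩
    exact Finset.disjoint_left.mp (hLU i) hi (hU i)
  · intro σ hσ σ' hσ' heq
    rw [Finset.mem_coe, Finset.mem_filter] at hσ hσ'
    exact hinj hσ.1 hσ'.1 heq

/-- **RIGHT BOUND, split form**: (H2) through the projection and the realisation of every tuple of the product set
(`SurjOn split s (mixed R U ×ˢ univ)`) give `(∏ i, (#R i + #U i) − ∏ i, #U i) · #T ≤ #{σ ∈ s | ¬inv ∧ ¬good ∧ rho}`. -/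
theorem le_card_not_inv_not_good_rho_of_split (R U : ∀ i, Finset (S i)) (hRU : ∀ i, Disjoint (R i) (U i))
    (hsurj : Set.SurjOn split s ((mixed R U ×ˢ (univ : Finset T) : Finset ((∀ i, S i) × T)) : Set _))
    (H2 : ∀ σ ∈ s, (∀ i, (split σ).1 i ∈ R i ∪ U i) → (∃ i, (split σ).1 i ∈ R i) →
      ¬ inv σ ∧ ¬ good σ ∧ rho σ) :
    (∏ i, ((R i).card + (U i).card) - ∏ i, (U i).card) * Fintype.card T
      ≤ (s.filter fun σ => ¬ inv σ ∧ ¬ good σ ∧ rho σ).card := by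
  rw [← card_mixed R U hRU, ← Finset.card_univ, ← Finset.card_product]
  apply Finset.card_le_card_of_surjOn split
  intro x hx
  obtain ⟨σ, hσ, rfl⟩ := hsurj hx
  rw [Finset.mem_coe, Finset.mem_product, mem_mixed] at hx
  obtain ⟨⟨h1, h2⟩, -⟩ := hx
  refine ⟨σ, ?_, rfl⟩
  rw [Finset.mem_coe, Finset.mem_filter]
  refine ⟨hσ, H2 σ hσ h1 ?_⟩
  by_contra hne
  apply h2
  intro i
  rcases Finset.mem_union.mp (h1 i) with hR | hU
  · exact absurd ⟨i, hR⟩ hne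
  · exact hU

/-- **ZONE-LEMMA FORM, split form**: `∀ i, #L i ≤ #R i`, the two product facts and (H1), (H2) give
`#{σ ∈ s | inv ∧ ¬rho} ≤ #{σ ∈ s | ¬inv ∧ ¬good ∧ rho}`. -/
theorem card_le_of_zone_card_le_of_split (L U R : ∀ i, Finset (S i))
    (hLU : ∀ i, Disjoint (L i) (U i)) (hRU : ∀ i, Disjoint (R i) (U i))
    (hinj : Set.InjOn split s)
    (hsurj : Set.SurjOn split s ((mixed R U ×ˢ (univ : Finset T) : Finset ((∀ i, S i) × T)) : Set _))
    (H1 : ∀ σ ∈ s, inv σ → ¬ rho σ → (∀ i, (split σ).1 i ∈ L i ∪ U i) ∧ ∃ i, (split σ).1 i ∈ L i)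
    (H2 : ∀ σ ∈ s, (∀ i, (split σ).1 i ∈ R i ∪ U i) → (∃ i, (split σ).1 i ∈ R i) →
      ¬ inv σ ∧ ¬ good σ ∧ rho σ)
    (hLR : ∀ i, (L i).card ≤ (R i).card) :
    (s.filter fun σ => inv σ ∧ ¬ rho σ).card ≤ (s.filter fun σ => ¬ inv σ ∧ ¬ good σ ∧ rho σ).card := by
  refine (card_inv_not_rho_le_of_split s split inv rho L U hLU hinj H1).trans ?_
  refine le_trans ?_ (le_card_not_inv_not_good_rho_of_split s split inv rho good R U hRU hsurj H2)
  apply Nat.mul_le_mul_right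
  apply Nat.sub_le_sub_right
  exact Finset.prod_le_prod (fun i _ => Nat.zero_le _) fun i _ => Nat.add_le_add_right (hLR i) _

end ZoneReduction

end PercRepro
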